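import Literature.Topology.FourManifolds.HandleFlipData
import Literature.Topology.FourManifolds.SlideRealisation
import Literature.Topology.FourManifolds.FlipRealisation
import Literature.Topology.FourManifolds.RealiseAlgebra
import Literature.Topology.FourManifolds.SPC4HandlesLemma2Direct
import Literature.Topology.FourManifolds.OneHandlebodyArcsExposed
import Literature.Topology.FourManifolds.InnerAutomorphismRealisation
import Literature.Topology.FourManifolds.DiffeotopyExtension
import Literature.Topology.FourManifolds.PointPushDiffeotopy
import Literature.Topology.FourManifolds.NielsenClosureConj
import Literature.Topology.FourManifolds.HandlesProofs
import Literature.Topology.FourManifolds.SPC4OneHandlebodyBoundaryProofs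
import Literature.AlgebraicTopology.FundamentalGroup.BallWithArcsBasis
import Literature.AlgebraicTopology.FundamentalGroup.BasePointTransfer
import HarnessLib

/-!
# Slides and flip of one `1`-handle, read on `π₁` (Laudenbach–Poénaru's `H₂`, `H₃`), and
# Laudenbach–Poénaru's Lemma 2 proved

Topic `Literature/Topology/FourManifolds` (fact seat
`provefact-Literature.Topology.FourManifolds.lauden-f709dd520c`, Laudenbach–Poénaru's Lemma 2).
Everything here is **proved**; no named facts.  The file has two parts.

## Part 1 — one handle (`Cobordism.IsNiceMorseFunction.handle_realise`)

For a `1`-handle `q` of a `1`-handlebody (nice Morse function `g`, gradient-like `ξ`, the ball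
`B = {g ≤ t₁}` of the `0`-handle) and the loop `x = [α₋ · C_q · α₊⁻¹]` through it (`C_q` the
arc of the handle, `α±` in `B` from the base point `x₀ ∈ B`), Part 1 packages the geometric
realisation theorems (`HandleFlipData.lean`, `SlideRealisation.lean`, `FlipRealisation.lean`)
into the algebraic form consumed by `RealiseAlgebra.lean`: a set
`H ⊆ π₁(W, x₀)` of classes (the loops below the seed collar of the flip context of `q`), closed
under inverses and containing the classes of all loops running in `B` and in the stable sets of
the other critical points, such that

* every `w ∈ H` gives a based self-diffeomorphism `G` acting trivially on `H` with
  `G_# x = x * w` — or every `w ∈ H` one with `G_# x = w * x`;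
* some based self-diffeomorphism `G` acting trivially on `H` has `G_# x = v * x⁻¹ * u` with
  `u, v ∈ H`.

(Products in Mathlib's `FundamentalGroup`: `p * q = q.trans p`.)

## Part 2 — all handles: Lemma 2 (`laudenbachPoenaru_exists_diffeoExtends_mapOfEq_eq_holds`)

Part 2 **discharges** the named fact `laudenbachPoenaru_exists_diffeoExtends_mapOfEq_eq`
(`SPC4HandlesProofs.lean`; Laudenbach–Poénaru, Bull. SMF 100 (1972), Lemma 2: every automorphism
of `π₁` of the boundary of a `4`-dimensional `1`-handlebody `V` is induced by a diffeomorphism of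
the boundary that extends over `V`).  By
`laudenbachPoenaru_exists_diffeoExtends_mapOfEq_eq_of_forall_realise`
(`SPC4HandlesLemma2Direct.lean`) it suffices to show
(`HasHandleDecomposition.exists_realise_autGenerators`): on every compact connected orientable
`4`-manifold `V` with a handle decomposition with one `0`-handle and `k` `1`-handles there are a
boundary point `z`, a basis `e : π₁(V, z) ≅ F_k` and a generating set `S` of `Aut F_k` each of
whose elements is induced by a self-diffeomorphism of `V` fixing `z`.  Following the paper
(pp. 339–340):

1. *Morse data.*  A nice Morse function `g` with one critical point of index `0`, `k` of index
   `1`, none of index `≥ 2` and a gradient-like field `ξ` (Milnor); the ball `B = {g ≤ t₁}` with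
   the left-hand discs (the cores of the `1`-handles) attached is a strong deformation retract of
   `V` (`exists_ball_union_leftHandDiscs`), so the loops `xᵢ = [αᵢ⁻ · Cᵢ · (αᵢ⁺)⁻¹]` through
   the cores form a free basis of `π₁(V, x₀)`, `x₀ ∈ B` (`BallWithArcsBasis`).
2. *Slides and flips.*  For each handle `q`, Part 1 gives based self-diffeomorphisms of `V`
   realising `x_q ↦ x_q w` (or `w x_q`) for every element `w` of `π₁` below the handle and
   `x_q ↦ v x_q⁻¹ u`, all fixing the classes below the handle — Laudenbach–Poénaru's `H₃`, `H₂`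
   with the explicit correction terms — hence (`RealiseAlgebra.lean`, the "elementary exercise"
   of p. 340) every elementary Nielsen automorphism in the basis `e`, at the base point `x₀`.
3. *Base point.*  Each of these diffeomorphisms is corrected by an ambient diffeotopy pushing the
   image of the boundary point `z` back to `z` (`PointPushDiffeotopy`, `DiffeotopyExtension`);
   on `π₁(V, z)` (basis `e ∘ T_ζ⁻¹` transported along a path `ζ : z ⟶ x₀`) the corrected map
   induces the Nielsen automorphism up to an inner automorphism (`BasePointTransfer`), and all
   inner automorphisms are induced at `z` (`InnerAutomorphismRealisation`).  Nielsen's theorem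
   (`NielsenClosureConj.closure_eq_top_of_conj_mul_nielsen_mem`) makes these a generating set.

## References

* F. Laudenbach, V. Poénaru, *A note on 4-dimensional handlebodies*, Bull. Soc. Math. France
  100 (1972) 337–344, §2, Lemma 2 and its proof (pp. 339–340).  Held:
  `lit read doi-10-24033-bsmf-1741`. [LaudenbachPoenaruBSMF1972]
* J. Milnor, *Lectures on the h-cobordism theorem* (1965), §§3–4, Thms. 3.13, 4.2.
  [MilnorHCobordism1965]
* A. Hatcher, *Algebraic Topology* (2002), §1.1, Example 1.22, Lemma 1.19. [HatcherAT2002]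
* D. L. Johnson, *Presentations of Groups* (1997), Ch. 3 §4 (Nielsen's theorem). [Johnson1997]
-/

open scoped Manifold ContDiff Topology unitInterval
open Set Function Metric

noncomputable section

namespace Literature.Topology.FourManifolds

open BoundaryManifold Literature.AlgebraicTopology.FundamentalGroup

universe u

variable {n : ℕ} {W : Type u} [TopologicalSpace W] [T2Space W] [SecondCountableTopology W]
  [CompactSpace W] [ChartedSpace (EuclideanHalfSpace (n + 1)) W] [IsManifold (𝓡∂ (n + 1)) ∞ W]

/-- **A self-map which is the identity on the range of a loop fixes its class.** [folklore] -/
theorem mapOfEq_fromPath_eq_self_of_forall_eq {X : Type*} [TopologicalSpace X] (G : C(X, X)) {x₀ : X}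
    (hG : G x₀ = x₀) (γ : Path x₀ x₀) (h : ∀ s, G (γ s) = γ s) :
    FundamentalGroup.mapOfEq G hG (FundamentalGroup.fromPath (Path.Homotopic.Quotient.mk γ)) =
      FundamentalGroup.fromPath (Path.Homotopic.Quotient.mk γ) := by
  rw [FundamentalGroup.mapOfEq_apply]
  change (Path.Homotopic.Quotient.map (Path.Homotopic.Quotient.mk γ) G).cast hG.symm hG.symm = _
  rw [← Path.Homotopic.Quotient.mk_map, ← Path.Homotopic.Quotient.mk_cast]
  exact congrArg Path.Homotopic.Quotient.mk (by ext s; exact h s)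

set_option maxHeartbeats 800000 in
/-- **The slides and the flip of a `1`-handle, read on `π₁`** (see the module docstring).
[cite: LaudenbachPoenaruBSMF1972, §2, proof of Lemma 2 (pp. 339–340)] [cite: MilnorHCobordism1965, Thms. 3.13, 4.2] -/
theorem Cobordism.IsNiceMorseFunction.handle_realise (hn : 2 ≤ n)
    {g : (Cobordism.ofBoundary n W).W → ℝ} (hg : (Cobordism.ofBoundary n W).IsNiceMorseFunction g)
    (ξ : Cₛ^∞⟮𝓡∂ (n + 1); EuclideanSpace ℝ (Fin (n + 1)), (TangentSpace (𝓡∂ (n + 1)) : (Cobordism.ofBoundary n W).W → Type)⟯)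
    (hξ : IsGradientLike (𝓡∂ (n + 1)) g ξ)
    (hidx : ∀ z ∈ criticalSet (𝓡∂ (n + 1)) g, morseIndex (𝓡∂ (n + 1)) g z ≤ 1)
    (h0 : (criticalSetOfIndex (𝓡∂ (n + 1)) g 0).ncard = 1)
    (h2 : ∀ k, 2 ≤ k → (criticalSetOfIndex (𝓡∂ (n + 1)) g k).ncard = 0)
    {q : (Cobordism.ofBoundary n W).W} (hq : q ∈ criticalSetOfIndex (𝓡∂ (n + 1)) g 1)
    {t₁ : ℝ} (ht₀ : Cobordism.niceLevel n 0 < t₁) (ht₁ : t₁ < Cobordism.niceLevel n 1)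
    (oM : SmoothOrientation (𝓡∂ (n + 1)) (Cobordism.ofBoundary n W).W)
    {x₀ e₀ e₁ : (Cobordism.ofBoundary n W).W} (hx₀ : g x₀ ≤ t₁)
    (αm : Path x₀ e₀) (αp : Path x₀ e₁) (hαm : ∀ s, g (αm s) ≤ t₁) (hαp : ∀ s, g (αp s) ≤ t₁)
    (Cq : Path e₀ e₁) (hinj : Injective Cq) (hrange : range Cq = leftHandDisc (𝓡∂ (n + 1)) g ξ q t₁) :
    ∃ H : Set (FundamentalGroup (Cobordism.ofBoundary n W).W x₀),
      (∀ w ∈ H, w⁻¹ ∈ H) ∧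
      (∀ γ : Path x₀ x₀, (∀ s, g (γ s) ≤ t₁ ∨ ∃ q' ∈ criticalSet (𝓡∂ (n + 1)) g, q' ≠ q ∧ γ s ∈ stableSet (𝓡∂ (n + 1)) ξ q') →
        FundamentalGroup.fromPath (Path.Homotopic.Quotient.mk γ) ∈ H) ∧
      ((∀ w ∈ H, ∃ (G : (Cobordism.ofBoundary n W).W ≃ₘ⟮𝓡∂ (n + 1), 𝓡∂ (n + 1)⟯ (Cobordism.ofBoundary n W).W) (hG : G x₀ = x₀),
          (∀ w' ∈ H, FundamentalGroup.mapOfEq (⟨G, G.continuous⟩ : C(_, _)) hG w' = w') ∧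
          FundamentalGroup.mapOfEq (⟨G, G.continuous⟩ : C(_, _)) hG
            (FundamentalGroup.fromPath (Path.Homotopic.Quotient.mk ((αm.trans Cq).trans αp.symm))) =
            FundamentalGroup.fromPath (Path.Homotopic.Quotient.mk ((αm.trans Cq).trans αp.symm)) * w) ∨
       (∀ w ∈ H, ∃ (G : (Cobordism.ofBoundary n W).W ≃ₘ⟮𝓡∂ (n + 1), 𝓡∂ (n + 1)⟯ (Cobordism.ofBoundary n W).W) (hG : G x₀ = x₀),
          (∀ w' ∈ H, FundamentalGroup.mapOfEq (⟨G, G.continuous⟩ : C(_, _)) hG w' = w') ∧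
          FundamentalGroup.mapOfEq (⟨G, G.continuous⟩ : C(_, _)) hG
            (FundamentalGroup.fromPath (Path.Homotopic.Quotient.mk ((αm.trans Cq).trans αp.symm))) =
            w * FundamentalGroup.fromPath (Path.Homotopic.Quotient.mk ((αm.trans Cq).trans αp.symm)))) ∧
      ∃ (G : (Cobordism.ofBoundary n W).W ≃ₘ⟮𝓡∂ (n + 1), 𝓡∂ (n + 1)⟯ (Cobordism.ofBoundary n W).W) (hG : G x₀ = x₀),
        ∃ u ∈ H, ∃ v ∈ H, (∀ w' ∈ H, FundamentalGroup.mapOfEq (⟨G, G.continuous⟩ : C(_, _)) hG w' = w') ∧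
          FundamentalGroup.mapOfEq (⟨G, G.continuous⟩ : C(_, _)) hG
            (FundamentalGroup.fromPath (Path.Homotopic.Quotient.mk ((αm.trans Cq).trans αp.symm))) =
            v * (FundamentalGroup.fromPath (Path.Homotopic.Quotient.mk ((αm.trans Cq).trans αp.symm)))⁻¹ * u := by
  obtain ⟨L, C, hLq, hLb, h, hφ, hφs, hnn, hpos, h0C, h2C, hminC, hball, hstable⟩ :=
    hg.exists_flipContext_compat hn ξ hξ hidx h0 h2 hq ht₀ ht₁ oM
  have hτ := C.τ_pos
  have hrange' : range Cq = leftHandDisc (𝓡∂ (n + 1)) g ξ L.q L.b := by rw [hrange, hLq, hLb]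
  have hx₀' : C.S.f x₀ ≤ C.c - 3 * C.τ := (hball x₀ hx₀).trans (by linarith)
  have hx₀'' : C.S.f x₀ ≤ C.c - 2 * C.τ := (hball x₀ hx₀).trans (by linarith)
  have hαm' : ∀ s, C.S.f (αm s) ≤ C.c - 2 * C.τ := fun s => (hball _ (hαm s)).trans (by linarith)
  have hαp' : ∀ s, C.S.f (αp s) ≤ C.c - 2 * C.τ := fun s => (hball _ (hαp s)).trans (by linarith)
  -- the set `H` of classes of loops below the seed collar
  refine ⟨{w | ∃ γ : Path x₀ x₀, (∀ s, C.S.f (γ s) ≤ C.c - 2 * C.τ) ∧ FundamentalGroup.fromPath (Path.Homotopic.Quotient.mk γ) = w},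
    ?_, ?_, ?_, ?_⟩
  · -- closed under inverses
    rintro w ⟨γ, hγ, rfl⟩
    exact ⟨γ.symm, fun s => hγ _, rfl⟩
  · -- contains the loops of the ball and of the stable sets of the other critical points
    intro γ hγ
    refine ⟨γ, fun s => ?_, rfl⟩
    rcases hγ s with hs | ⟨q', hq', hq'q, hs⟩
    · exact (hball _ hs).trans (by linarith)
    · exact (hstable q' hq' hq'q _ hs).trans (by linarith)
  · -- the slides
    have hfix : ∀ {G : (Cobordism.ofBoundary n W).W ≃ₘ⟮𝓡∂ (n + 1), 𝓡∂ (n + 1)⟯ (Cobordism.ofBoundary n W).W} (hG : G x₀ = x₀),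
        (∀ x, C.S.f x ≤ C.c - 2 * C.τ → G x = x) →
        ∀ w' ∈ {w | ∃ γ : Path x₀ x₀, (∀ s, C.S.f (γ s) ≤ C.c - 2 * C.τ) ∧ FundamentalGroup.fromPath (Path.Homotopic.Quotient.mk γ) = w},
          FundamentalGroup.mapOfEq (⟨G, G.continuous⟩ : C(_, _)) hG w' = w' := by
      rintro G hG hid w' ⟨γ, hγ, rfl⟩
      exact mapOfEq_fromPath_eq_self_of_forall_eq _ hG γ fun s => hid _ (hγ s)
    rcases h.exists_slide_realise Cq hinj hrange' hnn hpos h0C h2C hminC hx₀' αm αp hαm' hαp' with hA | hB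
    · right
      rintro w ⟨γ, hγ, rfl⟩
      obtain ⟨Ψ, hΨ, hid, hx⟩ := hA γ hγ
      exact ⟨Ψ, hΨ, hfix hΨ hid, by rw [FundamentalGroup.mul_def]; exact hx⟩
    · left
      rintro w ⟨γ, hγ, rfl⟩
      obtain ⟨Ψ, hΨ, hid, hx⟩ := hB γ hγ
      exact ⟨Ψ, hΨ, hfix hΨ hid, by rw [FundamentalGroup.mul_def]; exact hx⟩
  · -- the flip
    obtain ⟨Ψ, hΨ, hid, u, v, hu, hv, hx⟩ := h.exists_flip_realise hφ hφs Cq hinj hrange' hnn hpos hx₀'' αm αp hαm' hαp'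
    refine ⟨Ψ, hΨ, FundamentalGroup.fromPath (Path.Homotopic.Quotient.mk u), ⟨u, hu, rfl⟩,
      FundamentalGroup.fromPath (Path.Homotopic.Quotient.mk v), ⟨v, hv, rfl⟩, ?_, ?_⟩
    · rintro w' ⟨γ, hγ, rfl⟩
      exact mapOfEq_fromPath_eq_self_of_forall_eq _ hΨ γ fun s => hid _ (hγ s)
    · rw [hx, FundamentalGroup.mul_def, FundamentalGroup.mul_def, FundamentalGroup.inv_def]
      exact Path.Homotopic.Quotient.trans_assoc _ _ _

/-! ## Part 2 — Laudenbach–Poénaru's Lemma 2 on every decomposed `1`-handlebody -/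

/-! ### Helpers: induced automorphisms of `π₁` -/

section Pi1

variable {X : Type*} [TopologicalSpace X] {x₀ : X}

/-- `mapOfEq` on the element of `π₁` given by a loop. [folklore] -/
theorem mapOfEq_fromPath_mk (F : C(X, X)) (hF : F x₀ = x₀) (γ : Path x₀ x₀) :
    FundamentalGroup.mapOfEq F hF (FundamentalGroup.fromPath (Path.Homotopic.Quotient.mk γ)) =
      FundamentalGroup.fromPath (Path.Homotopic.Quotient.mk ((γ.map (map_continuous F)).cast hF.symm hF.symm)) := by
  rw [FundamentalGroup.mapOfEq_apply]
  change (Path.Homotopic.Quotient.map (Path.Homotopic.Quotient.mk γ) F).cast hF.symm hF.symm = _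
  rw [← Path.Homotopic.Quotient.mk_map, ← Path.Homotopic.Quotient.mk_cast]

/-- **Functoriality of `mapOfEq` at a fixed base point**: `F_# (G_# c) = (F ∘ G)_# c`. [folklore] -/
theorem mapOfEq_mapOfEq (F G : C(X, X)) (hF : F x₀ = x₀) (hG : G x₀ = x₀) (hFG : (F.comp G) x₀ = x₀)
    (c : FundamentalGroup X x₀) :
    FundamentalGroup.mapOfEq F hF (FundamentalGroup.mapOfEq G hG c) = FundamentalGroup.mapOfEq (F.comp G) hFG c := by
  induction c using Quotient.ind with | _ γ =>
  change FundamentalGroup.mapOfEq F hF (FundamentalGroup.mapOfEq G hG (FundamentalGroup.fromPath (Path.Homotopic.Quotient.mk γ))) =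
    FundamentalGroup.mapOfEq (F.comp G) hFG (FundamentalGroup.fromPath (Path.Homotopic.Quotient.mk γ))
  rw [mapOfEq_fromPath_mk, mapOfEq_fromPath_mk, mapOfEq_fromPath_mk]
  exact congrArg (fun p => FundamentalGroup.fromPath (Path.Homotopic.Quotient.mk p)) (by ext s; rfl)

/-- A self-map equal to the identity induces the identity on `π₁`. [folklore] -/
theorem mapOfEq_eq_self_of_forall_eq (F : C(X, X)) (hF : F x₀ = x₀) (h : ∀ x, F x = x) (c : FundamentalGroup X x₀) :
    FundamentalGroup.mapOfEq F hF c = c := by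
  induction c using Quotient.ind with | _ γ =>
  change FundamentalGroup.mapOfEq F hF (FundamentalGroup.fromPath (Path.Homotopic.Quotient.mk γ)) =
    FundamentalGroup.fromPath (Path.Homotopic.Quotient.mk γ)
  rw [mapOfEq_fromPath_mk]
  exact congrArg (fun p => FundamentalGroup.fromPath (Path.Homotopic.Quotient.mk p)) (by ext s; exact h _)

end Pi1

section Diffeo

variable {E H : Type*} [NormedAddCommGroup E] [NormedSpace ℝ E] [TopologicalSpace H] {J : ModelWithCorners ℝ E H}
  {M : Type*} [TopologicalSpace M] [ChartedSpace H M] {x₀ : M}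

/-- **A self-diffeomorphism fixing `x₀` induces an automorphism of `π₁(M, x₀)`** (its inverse is
induced by the inverse diffeomorphism). [folklore] -/
theorem exists_mulAut_apply_eq_mapOfEq (G : M ≃ₘ⟮J, J⟯ M) (hG : G x₀ = x₀) :
    ∃ A : MulAut (FundamentalGroup M x₀), ∀ c, A c = FundamentalGroup.mapOfEq (⟨G, G.continuous⟩ : C(M, M)) hG c :=
  ⟨(FundamentalGroup.mapOfEq (⟨G, G.continuous⟩ : C(M, M)) hG).toMulEquiv
    (FundamentalGroup.mapOfEq (⟨G.symm, G.symm.continuous⟩ : C(M, M))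
      (by show G.symm x₀ = x₀; have h := congrArg G.symm hG; rw [G.symm_apply_apply] at h; exact h.symm))
    (by
      ext c
      rw [MonoidHom.comp_apply, mapOfEq_mapOfEq _ _ _ _ (by simp)]
      exact mapOfEq_eq_self_of_forall_eq _ _ (fun x => G.symm_apply_apply x) c)
    (by
      ext c
      rw [MonoidHom.comp_apply, mapOfEq_mapOfEq _ _ _ _ (by simp)]
      exact mapOfEq_eq_self_of_forall_eq _ _ (fun x => G.apply_symm_apply x) c), fun _ => rfl⟩

/-- The composite of two based self-diffeomorphisms induces the composite automorphism. [folklore] -/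
theorem mapOfEq_trans (G₁ G₂ : M ≃ₘ⟮J, J⟯ M) (h₁ : G₁ x₀ = x₀) (h₂ : G₂ x₀ = x₀) (c : FundamentalGroup M x₀) :
    FundamentalGroup.mapOfEq (⟨G₁, G₁.continuous⟩ : C(M, M)) h₁ (FundamentalGroup.mapOfEq (⟨G₂, G₂.continuous⟩ : C(M, M)) h₂ c) =
      FundamentalGroup.mapOfEq (⟨G₂.trans G₁, (G₂.trans G₁).continuous⟩ : C(M, M)) (by show G₁ (G₂ x₀) = x₀; rw [h₂, h₁]) c := by
  induction c using Quotient.ind with | _ γ =>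
  change FundamentalGroup.mapOfEq _ h₁ (FundamentalGroup.mapOfEq _ h₂ (FundamentalGroup.fromPath (Path.Homotopic.Quotient.mk γ))) =
    FundamentalGroup.mapOfEq _ _ (FundamentalGroup.fromPath (Path.Homotopic.Quotient.mk γ))
  rw [mapOfEq_fromPath_mk, mapOfEq_fromPath_mk, mapOfEq_fromPath_mk]
  exact congrArg (fun p => FundamentalGroup.fromPath (Path.Homotopic.Quotient.mk p)) (by ext s; rfl)

end Diffeo

/-! ### Helper: a diameter of the closed unit ball of `ℝ¹` -/

section Segment

/-- **A diameter of the closed unit ball of `ℝ¹`**: two antipodal points of norm one and an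
injective path from the one to the other filling the ball (the straight segment). [folklore] -/
theorem exists_path_antipodal_injective_range_eq_univ :
    ∃ (a b : closedBall (0 : EuclideanSpace ℝ (Fin 1)) 1) (γ : Path a b),
      ‖(a : EuclideanSpace ℝ (Fin 1))‖ = 1 ∧ (b : EuclideanSpace ℝ (Fin 1)) = -(a : EuclideanSpace ℝ (Fin 1)) ∧
      Injective γ ∧ range γ = univ := by
  -- the unit vector of `ℝ¹`
  set u : EuclideanSpace ℝ (Fin 1) := EuclideanSpace.single 0 1 with hu
  have hnorm : ‖u‖ = 1 := by simp [hu]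
  have hu0 : u 0 = 1 := by simp [hu]
  have hsmul : ∀ y : EuclideanSpace ℝ (Fin 1), y = y 0 • u := fun y => by
    ext i
    fin_cases i
    simp [hu]
  have ha : u ∈ closedBall (0 : EuclideanSpace ℝ (Fin 1)) 1 := by rw [mem_closedBall, dist_zero_right, hnorm]
  have hb : -u ∈ closedBall (0 : EuclideanSpace ℝ (Fin 1)) 1 := by rw [mem_closedBall, dist_zero_right, norm_neg, hnorm]
  -- the straight segment from `u` to `-u`
  let γ : Path (⟨u, ha⟩ : closedBall (0 : EuclideanSpace ℝ (Fin 1)) 1) ⟨-u, hb⟩ :=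
    { toFun := fun t => ⟨(1 - (t : ℝ)) • u + (t : ℝ) • (-u),
        (convex_closedBall (0 : EuclideanSpace ℝ (Fin 1)) 1) ha hb (by linarith [unitInterval.le_one t]) (unitInterval.nonneg t)
          (by ring)⟩
      continuous_toFun := by
        refine Continuous.subtype_mk ?_ _
        exact ((continuous_const.sub continuous_subtype_val).smul continuous_const).add
          (continuous_subtype_val.smul continuous_const)
      source' := by ext; simp
      target' := by ext; simp }
  have hγ : ∀ t : I, ((γ t : closedBall (0 : EuclideanSpace ℝ (Fin 1)) 1) : EuclideanSpace ℝ (Fin 1)) =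
      (1 - (t : ℝ)) • u + (t : ℝ) • (-u) := fun t => rfl
  have hγ0 : ∀ t : I, ((γ t : closedBall (0 : EuclideanSpace ℝ (Fin 1)) 1) : EuclideanSpace ℝ (Fin 1)) 0 = 1 - 2 * (t : ℝ) :=
      fun t => by
    rw [hγ t]
    simp only [smul_neg, PiLp.add_apply, PiLp.smul_apply, PiLp.neg_apply, hu0, smul_eq_mul, mul_one]
    ring
  refine ⟨⟨u, ha⟩, ⟨-u, hb⟩, γ, hnorm, rfl, fun s t h => ?_, eq_univ_of_forall fun y => ?_⟩
  · -- injective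
    have h0 := congrArg (fun v : closedBall (0 : EuclideanSpace ℝ (Fin 1)) 1 => (v : EuclideanSpace ℝ (Fin 1)) 0) h
    simp only [hγ0] at h0
    exact Subtype.ext (by linarith)
  · -- onto
    have hy : |(y : EuclideanSpace ℝ (Fin 1)) 0| ≤ 1 := by
      have h := y.2
      rw [mem_closedBall, dist_zero_right, hsmul (y : EuclideanSpace ℝ (Fin 1)), norm_smul, hnorm, mul_one,
        Real.norm_eq_abs] at h
      exact h
    rw [abs_le] at hy
    refine ⟨⟨(1 - (y : EuclideanSpace ℝ (Fin 1)) 0) / 2, by constructor <;> linarith [hy.1, hy.2]⟩, ?_⟩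
    apply Subtype.ext
    rw [hγ]
    show (1 - (1 - (y : EuclideanSpace ℝ (Fin 1)) 0) / 2) • u + ((1 - (y : EuclideanSpace ℝ (Fin 1)) 0) / 2) • (-u) =
      (y : EuclideanSpace ℝ (Fin 1))
    conv_rhs => rw [hsmul (y : EuclideanSpace ℝ (Fin 1))]
    rw [smul_neg, ← sub_eq_add_neg, ← sub_smul]
    congr 1
    ring

end Segment

/-! ### Transfer of a based realisation to a boundary base point -/

section Transfer

variable {V : Type u} [TopologicalSpace V] [T2Space V] [SecondCountableTopology V] [CompactSpace V]
  [ConnectedSpace V] [ChartedSpace (EuclideanHalfSpace 4) V] [IsManifold (𝓡∂ 4) ∞ V]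

omit [SecondCountableTopology V] [ConnectedSpace V] in
/-- **Correcting a self-diffeomorphism fixing `x₀` to one fixing the boundary point `z`**, with
the induced automorphism of `π₁(V, z)` controlled up to an inner automorphism: compose with the
end stage of an ambient diffeotopy extending a point push of `∂V` taking `G z` back to `z`
(`BasePointTransfer.mapOfEq_comp_pathConj`). [cite: LaudenbachPoenaruBSMF1972, §2 (p. 339)]
[cite: HirschDT1976, Ch. 8 §1 Thm. 1.3, §2] [cite: HatcherAT2002, Lemma 1.19] -/
theorem exists_diffeomorph_fix_boundaryPoint (b : BoundaryData (𝓡∂ 4) V (𝓡 3)) [ConnectedSpace b.carrier]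
    (z₀ : b.carrier) {x₀ : V} (ζ : Path (b.incl z₀) x₀) (G : V ≃ₘ⟮𝓡∂ 4, 𝓡∂ 4⟯ V) (hG : G x₀ = x₀) :
    ∃ (G' : V ≃ₘ⟮𝓡∂ 4, 𝓡∂ 4⟯ V) (hG' : G' (b.incl z₀) = b.incl z₀) (X : FundamentalGroup V (b.incl z₀)),
      ∀ c : FundamentalGroup V x₀,
        FundamentalGroup.mapOfEq (⟨G', G'.continuous⟩ : C(V, V)) hG' (BasePointTransfer.pathConj ζ c) =
          X⁻¹ * BasePointTransfer.pathConj ζ (FundamentalGroup.mapOfEq (⟨G, G.continuous⟩ : C(V, V)) hG c) * X := by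
  haveI : T2Space b.carrier := b.isSmoothEmbedding.isEmbedding.t2Space
  haveI : CompactSpace b.carrier := b.compactSpace_carrier
  haveI : LocallyPathConnectedSpace b.carrier := ChartedSpace.locallyPathConnectedSpace (EuclideanSpace ℝ (Fin 3)) _
  haveI : PathConnectedSpace b.carrier := pathConnectedSpace_iff_connectedSpace.2 inferInstance
  -- `G z` is a boundary point `b.incl z₂`
  have hGz : G (b.incl z₀) ∈ (𝓡∂ 4).boundary V := by
    rw [← G.image_boundary (by simp)]
    exact mem_image_of_mem _ (b.range_incl ▸ mem_range_self z₀)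
  rw [← b.range_incl] at hGz
  obtain ⟨z₂, hz₂⟩ := hGz
  -- push `z₂` back to `z₀` inside the boundary, extend to an ambient diffeotopy
  obtain ⟨D, -, -, -, -, -, -, h1, -⟩ := exists_diffeotopy_apply_eq_trackPath_homotopic (n := 3)
    (PathConnectedSpace.somePath z₂ z₀) isOpen_univ (subset_univ _)
  obtain ⟨Gt, hGt⟩ := BoundaryData.exists_diffeotopy_comp_incl_eq_of_compactSpace 2 b D
  set ρ : V ≃ₘ⟮𝓡∂ 4, 𝓡∂ 4⟯ V := Gt.stage 1 with hρ
  have hρz : ρ (G (b.incl z₀)) = b.incl z₀ := by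
    rw [← hz₂]
    show Gt.toFun 1 (b.incl z₂) = b.incl z₀
    have := congrFun (hGt 1) z₂
    simp only [comp_apply] at this
    rw [this, h1]
  -- the homotopy from the identity to `ρ`
  let F : ContinuousMap.Homotopy (ContinuousMap.id V) (⟨ρ, ρ.continuous⟩ : C(V, V)) :=
    { toFun := fun p => Gt.toFun p.1 p.2
      continuous_toFun := Gt.contMDiff_uncurry_toFun.continuous.comp (continuous_subtype_val.prodMap continuous_id)
      map_zero_left := fun x => by show Gt.toFun 0 x = x; rw [Gt.toFun_zero]; rfl
      map_one_left := fun x => rfl }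
  -- the track of `G z` and the image of `ζ`
  let t : Path (G (b.incl z₀)) (b.incl z₀) :=
    { toFun := fun s => Gt.toFun s (G (b.incl z₀))
      continuous_toFun := Gt.contMDiff_uncurry_toFun.continuous.comp (continuous_subtype_val.prodMk continuous_const)
      source' := by show Gt.toFun 0 _ = _; rw [Gt.toFun_zero]; rfl
      target' := hρz }
  let A : Path (G (b.incl z₀)) x₀ := (ζ.map G.continuous).cast rfl hG.symm
  have hGG' : ((⟨ρ, ρ.continuous⟩ : C(V, V)).comp ⟨G, G.continuous⟩) (b.incl z₀) = b.incl z₀ := hρz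
  refine ⟨G.trans ρ, hρz, FundamentalGroup.fromPath (((Path.Homotopic.Quotient.mk t).symm.trans (Path.Homotopic.Quotient.mk A)).trans
      (Path.Homotopic.Quotient.mk ζ).symm), fun c => ?_⟩
  have key := BasePointTransfer.mapOfEq_comp_pathConj (⟨G, G.continuous⟩ : C(V, V)) (⟨ρ, ρ.continuous⟩ : C(V, V)) F hG hρz ζ
    t (fun s => rfl) A (fun s => rfl) c
  exact key

end Transfer

/-! ### The realisation on every decomposed `1`-handlebody -/

set_option maxHeartbeats 3200000 in
/-- **REALISE∀.**  On every compact connected orientable smooth `4`-manifold `V` with a handle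
decomposition with one `0`-handle and `k` `1`-handles there are a boundary point `z`, an
isomorphism `e : π₁(V, z) ≅ F_k` and a generating set `S` of `Aut F_k` every element of which is
induced, through `e`, by a self-diffeomorphism of `V` fixing `z` (see the module docstring for the
proof). [cite: LaudenbachPoenaruBSMF1972, §2, Lemma 2 and its proof (pp. 339–340)] -/
theorem HasHandleDecomposition.exists_realise_autGenerators (k : ℕ) (V : Type u) [TopologicalSpace V] [T2Space V] [SecondCountableTopology V]
    [CompactSpace V] [ConnectedSpace V] [ChartedSpace (EuclideanHalfSpace 4) V] [IsManifold (𝓡∂ 4) ∞ V]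
    (hk : HasHandleDecomposition 3 V (handleCount 1 k)) (ho : IsOrientable (𝓡∂ 4) V) :
    ∃ (z : V) (_ : z ∈ (𝓡∂ 4).boundary V) (e : FundamentalGroup V z ≃* FreeGroup (Fin k))
      (S : Set (MulAut (FreeGroup (Fin k)))), Subgroup.closure S = ⊤ ∧
      ∀ ν ∈ S, ∃ (G : V ≃ₘ⟮𝓡∂ 4, 𝓡∂ 4⟯ V) (hGz : G z = z),
        ∀ c : FundamentalGroup V z,
          FundamentalGroup.mapOfEq (⟨G, G.continuous⟩ : C(V, V)) hGz c = e.symm (ν (e c)) := by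
  classical
  haveI : CompactSpace ((𝓡∂ (3 + 1)).boundary V) := compactSpace_boundary 3 V
  haveI : LocallyPathConnectedSpace V := ChartedSpace.locallyPathConnectedSpace (EuclideanHalfSpace 4) V
  haveI : PathConnectedSpace V := pathConnectedSpace_iff_connectedSpace.2 inferInstance
  obtain ⟨oM⟩ := ho
  /- 1. Morse data -/
  obtain ⟨f, hf, hcount⟩ := hk
  obtain ⟨s, -, hF, hSf⟩ := hf.exists_isMorseFunction_ofBoundary
  obtain ⟨g, hg, hcrit, hind⟩ := Cobordism.Milnor1965_finalRearrangement_holds hF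
  have hSg : ∀ j, criticalSetOfIndex (𝓡∂ (3 + 1)) g j = criticalSetOfIndex (𝓡∂ (3 + 1)) f j :=
    fun j => (criticalSetOfIndex_congr hcrit hind j).trans (hSf j)
  have h0 : (criticalSetOfIndex (𝓡∂ (3 + 1)) g 0).ncard = 1 := by rw [hSg]; exact (hcount 0).trans (handleCount_zero 1 k)
  have h1 : (criticalSetOfIndex (𝓡∂ (3 + 1)) g 1).ncard = k := by rw [hSg]; exact (hcount 1).trans (handleCount_one 1 k)
  have h2 : ∀ j, 2 ≤ j → (criticalSetOfIndex (𝓡∂ (3 + 1)) g j).ncard = 0 := fun j hj => by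
    rw [hSg]; exact (hcount j).trans (handleCount_of_two_le 1 k hj)
  have hgM : (Cobordism.ofBoundary 3 V).IsMorseFunction g := hg.1
  have hfin : (criticalSet (𝓡∂ (3 + 1)) g).Finite := IsMorse.finite_criticalSet_holds hgM.isMorse
  have hidx : ∀ z ∈ criticalSet (𝓡∂ (3 + 1)) g, morseIndex (𝓡∂ (3 + 1)) g z ≤ 1 := by
    intro z hz
    by_contra hlt
    have h2le : 2 ≤ morseIndex (𝓡∂ (3 + 1)) g z := by omega
    have hmem : z ∈ criticalSetOfIndex (𝓡∂ (3 + 1)) g (morseIndex (𝓡∂ (3 + 1)) g z) := ⟨mem_criticalSet.1 hz, rfl⟩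
    have hfin' : (criticalSetOfIndex (𝓡∂ (3 + 1)) g (morseIndex (𝓡∂ (3 + 1)) g z)).Finite :=
      hfin.subset (criticalSetOfIndex_subset _ g _)
    rw [(Set.ncard_eq_zero hfin').1 (h2 _ h2le)] at hmem
    exact hmem
  obtain ⟨ξ, hξ⟩ := Cobordism.Milnor1965_exists_isGradientLike_holds hgM
  have hval : ∀ z ∈ criticalSet (𝓡∂ (3 + 1)) g, g z = Cobordism.niceLevel 3 (morseIndex (𝓡∂ (3 + 1)) g z) :=
    fun z hz => hg.2 z (mem_criticalSet.1 hz)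
  /- 2. the ball and the cores of the `1`-handles; the basis of `π₁` -/
  obtain ⟨p₀, t₁, β, instP, Φ, hp₀, hgp₀, ht₁0, ht₁1, ht₁P, hβinj, hβrange, hcard, hΦinj, hΦrange, -, hΦB, hΦdisj, hsdr⟩ :=
    hg.exists_ball_union_leftHandDiscs ξ hξ h0 h1 h2
  have hp₀val : g p₀ = Cobordism.niceLevel 3 0 := by
    have hp₀mem : p₀ ∈ criticalSetOfIndex (𝓡∂ (3 + 1)) g 0 := by rw [hp₀]; exact mem_singleton p₀
    rw [hval p₀ (mem_criticalSet.2 hp₀mem.1), hp₀mem.2]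
  have ht₀' : Cobordism.niceLevel 3 0 < t₁ := hp₀val ▸ hgp₀
  have ht₁' : ∀ i : ↥(criticalSetOfIndex (𝓡∂ (3 + 1)) g 1), t₁ < Cobordism.niceLevel 3 1 := fun i => by
    have h := ht₁P i.1 i.2
    have e1 : g i.1 = Cobordism.niceLevel 3 1 := (hval i.1 (mem_criticalSet.2 i.2.1)).trans (congrArg _ i.2.2)
    rwa [e1] at h
  -- the base point and the paths in the ball
  have h0B : (0 : EuclideanSpace ℝ (Fin (3 + 1))) ∈ closedBall (0 : EuclideanSpace ℝ (Fin (3 + 1))) 1 := mem_closedBall_self zero_le_one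
  set x₀ : V := β ⟨0, h0B⟩ with hx₀def
  have hx₀B : x₀ ∈ range β := mem_range_self _
  have hends : ∀ (i : ↥(criticalSetOfIndex (𝓡∂ (3 + 1)) g 1)) (v : closedBall (0 : EuclideanSpace ℝ (Fin 1)) 1), ‖(v : EuclideanSpace ℝ (Fin 1))‖ = 1 →
      ∃ y : closedBall (0 : EuclideanSpace ℝ (Fin (3 + 1))) 1, β y = Φ i v := fun i v hv => by
    obtain ⟨y, hy⟩ := (hΦB i v).2 hv; exact ⟨y, hy⟩
  -- the diameter of the model interval, and paths in the (convex) model ball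
  obtain ⟨pP, pM, dγ, hplus, hanti, hdγinj, hdγrange⟩ := exists_path_antipodal_injective_range_eq_univ
  have hminus : ‖((pM : closedBall (0 : EuclideanSpace ℝ (Fin 1)) 1) : EuclideanSpace ℝ (Fin 1))‖ = 1 := by
    rw [hanti, norm_neg, hplus]
  haveI : PathConnectedSpace (closedBall (0 : EuclideanSpace ℝ (Fin (3 + 1))) 1) :=
    isPathConnected_iff_pathConnectedSpace.mp
      ((convex_closedBall (0 : EuclideanSpace ℝ (Fin (3 + 1))) 1).isPathConnected ⟨0, h0B⟩)
  have hBle : ∀ x ∈ range β, g x ≤ t₁ := fun x hx => by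
    have : x ∈ g ⁻¹' Iic t₁ := hβrange ▸ hx; exact this
  choose ym hym using fun i : ↥(criticalSetOfIndex (𝓡∂ (3 + 1)) g 1) => hends i pP hplus
  choose yp hyp using fun i : ↥(criticalSetOfIndex (𝓡∂ (3 + 1)) g 1) => hends i pM hminus
  set αm : ∀ i : ↥(criticalSetOfIndex (𝓡∂ (3 + 1)) g 1), Path x₀ (Φ i pP) := fun i =>
    ((PathConnectedSpace.somePath (⟨0, h0B⟩ : closedBall (0 : EuclideanSpace ℝ (Fin (3 + 1))) 1) (ym i)).map
      β.continuous).cast rfl (hym i).symm with hαm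
  set αp : ∀ i : ↥(criticalSetOfIndex (𝓡∂ (3 + 1)) g 1), Path x₀ (Φ i pM) := fun i =>
    ((PathConnectedSpace.somePath (⟨0, h0B⟩ : closedBall (0 : EuclideanSpace ℝ (Fin (3 + 1))) 1) (yp i)).map
      β.continuous).cast rfl (hyp i).symm with hαp
  have hαmB : ∀ i t, αm i t ∈ range β := fun i t => mem_range_self _
  have hαpB : ∀ i t, αp i t ∈ range β := fun i t => mem_range_self _
  obtain ⟨eP, heP⟩ := exists_mulEquiv_apply_of_eq_arcLoop_of_isStrongDeformationRetractOf β hβinj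
    (fun _ : ↥(criticalSetOfIndex (𝓡∂ (3 + 1)) g 1) => finrank_euclideanSpace_fin) Φ hΦB hΦinj hΦdisj hsdr (fun _ => pP) (fun _ => pM)
    (fun _ => hplus) (fun _ => hanti) (fun _ => dγ) hx₀B αm hαmB αp hαpB
  -- reindex by `Fin k`
  set eqv : ↥(criticalSetOfIndex (𝓡∂ (3 + 1)) g 1) ≃ Fin k := Fintype.equivFinOfCardEq hcard with heqv
  set e : FundamentalGroup V x₀ ≃* FreeGroup (Fin k) := eP.symm.trans (FreeGroup.freeGroupCongr eqv) with hedef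
  set Cq : ∀ i : ↥(criticalSetOfIndex (𝓡∂ (3 + 1)) g 1), Path (Φ i pP) (Φ i pM) := fun i => dγ.map (Φ i).continuous with hCq
  have he : ∀ i : ↥(criticalSetOfIndex (𝓡∂ (3 + 1)) g 1), e.symm (FreeGroup.of (eqv i)) =
      FundamentalGroup.fromPath (Path.Homotopic.Quotient.mk (((αm i).trans (Cq i)).trans (αp i).symm)) := fun i => by
    rw [hedef, MulEquiv.symm_trans_apply, FreeGroup.freeGroupCongr_symm, FreeGroup.freeGroupCongr_apply, FreeGroup.map.of,
      Equiv.symm_apply_apply, MulEquiv.symm_symm, heP i]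
  have he' : ∀ m : Fin k, e.symm (FreeGroup.of m) =
      FundamentalGroup.fromPath (Path.Homotopic.Quotient.mk (((αm (eqv.symm m)).trans (Cq (eqv.symm m))).trans (αp (eqv.symm m)).symm)) := fun m => by
    rw [← he, Equiv.apply_symm_apply]
  /- 3. the slides and the flip of every handle -/
  have hx₀t : g x₀ ≤ t₁ := hBle _ hx₀B
  have hCqinj : ∀ i, Injective (Cq i) := fun i => (hΦinj i).comp hdγinj
  have hCqrange : ∀ i : ↥(criticalSetOfIndex (𝓡∂ (3 + 1)) g 1), range (Cq i) = leftHandDisc (𝓡∂ (3 + 1)) g ξ i.1 t₁ := fun i => by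
    rw [← hΦrange i, hCq]
    show range (Φ i ∘ dγ) = _
    rw [range_comp, hdγrange, image_univ]
  have hCqstable : ∀ (j : ↥(criticalSetOfIndex (𝓡∂ (3 + 1)) g 1)) (z : (Cobordism.ofBoundary 3 V).W), z ∈ range (Cq j) →
      z ∈ stableSet (𝓡∂ (3 + 1)) ξ j.1 := fun j z hz => by
    rw [hCqrange j] at hz; exact hz.1
  have HR := fun i : ↥(criticalSetOfIndex (𝓡∂ (3 + 1)) g 1) => hg.handle_realise (by norm_num) ξ hξ hidx h0 h2 i.2 ht₀' (ht₁' i) oM hx₀t (αm i) (αp i)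
    (fun t => hBle _ (hαmB i t)) (fun t => hBle _ (hαpB i t)) (Cq i) (hCqinj i) (hCqrange i)
  choose H hHinv hHmem hHslide hHflip using HR
  /- 4. the algebra: every elementary Nielsen automorphism is realised at `x₀` -/
  set R : Set (MulAut (FundamentalGroup V x₀)) :=
    {φ | ∃ (G : V ≃ₘ⟮𝓡∂ 4, 𝓡∂ 4⟯ V) (hG : G x₀ = x₀), ∀ c, φ c = FundamentalGroup.mapOfEq (⟨G, G.continuous⟩ : C(V, V)) hG c} with hR
  have hRmul : ∀ φ ∈ R, ∀ ψ ∈ R, φ * ψ ∈ R := by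
    rintro φ ⟨G₁, h₁, hφ⟩ ψ ⟨G₂, h₂, hψ⟩
    refine ⟨G₂.trans G₁, by show G₁ (G₂ x₀) = x₀; rw [h₂, h₁], fun c => ?_⟩
    rw [MulAut.mul_apply, hψ, hφ, mapOfEq_trans]
  have hRmem : ∀ (G : V ≃ₘ⟮𝓡∂ 4, 𝓡∂ 4⟯ V) (hG : G x₀ = x₀),
      ∃ A ∈ R, ∀ c, A c = FundamentalGroup.mapOfEq (⟨G, G.continuous⟩ : C(V, V)) hG c := fun G hG => by
    obtain ⟨A, hA⟩ := exists_mulAut_apply_eq_mapOfEq G hG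
    exact ⟨A, ⟨G, hG, hA⟩, hA⟩
  -- the loops of the other handles lie below the seed collar of the handle `i`
  have hother : ∀ i j : ↥(criticalSetOfIndex (𝓡∂ (3 + 1)) g 1), j ≠ i → ∀ t, g ((((αm j).trans (Cq j)).trans (αp j).symm) t) ≤ t₁ ∨
      ∃ q' ∈ criticalSet (𝓡∂ (3 + 1)) g, q' ≠ i.1 ∧ (((αm j).trans (Cq j)).trans (αp j).symm) t ∈ stableSet (𝓡∂ (3 + 1)) ξ q' := by
    intro i j hji t
    rw [Path.trans_apply]
    split_ifs with h₁
    · rw [Path.trans_apply]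
      split_ifs with h₂
      · exact Or.inl (hBle _ (hαmB _ _))
      · right
        exact ⟨j.1, mem_criticalSet.2 j.2.1, fun h => hji (Subtype.ext h), hCqstable j _ (mem_range_self _)⟩
    · exact Or.inl (by rw [Path.symm_apply]; exact hBle _ (hαpB _ _))
  have REAL₀ := RealiseAlgebra.forall_nielsen_mem_of_slides_flips e R hRmul (fun m => H (eqv.symm m))
    (fun m m' hmm' => by rw [he' m']; exact hHmem _ _ (hother _ _ fun h => hmm' (by rw [← Equiv.apply_symm_apply eqv m', h, Equiv.apply_symm_apply])))
    (fun m => hHinv _)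
    (fun m => by
      rcases hHslide (eqv.symm m) with hA | hB
      · left
        intro w hw
        obtain ⟨G, hG, hfix, hx⟩ := hA w hw
        obtain ⟨A, hAR, hAe⟩ := hRmem G hG
        exact ⟨A, hAR, fun w' hw' => by rw [hAe]; exact hfix w' hw', by rw [hAe, he' m]; exact hx⟩
      · right
        intro w hw
        obtain ⟨G, hG, hfix, hx⟩ := hB w hw
        obtain ⟨A, hAR, hAe⟩ := hRmem G hG
        exact ⟨A, hAR, fun w' hw' => by rw [hAe]; exact hfix w' hw', by rw [hAe, he' m]; exact hx⟩)
    (fun m => by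
      obtain ⟨G, hG, u, hu, v, hv, hfix, hx⟩ := hHflip (eqv.symm m)
      obtain ⟨A, hAR, hAe⟩ := hRmem G hG
      exact ⟨A, hAR, u, hu, v, hv, fun w' hw' => by rw [hAe]; exact hfix w' hw', by rw [hAe, he' m]; exact hx⟩)
  /- 5. the boundary base point -/
  set b : BoundaryData (𝓡∂ 4) V (𝓡 3) := BoundaryManifold.boundaryData 3 V with hb
  have hkV : HasHandleDecomposition 3 V (handleCount 1 k) := ⟨f, hf, hcount⟩
  haveI : ConnectedSpace b.carrier :=
    connectedSpace_boundary_of_isHandlebodyOfIndexLE_one_holds V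
      (HasHandleDecomposition.isHandlebodyOfIndexLE_holds hkV fun j hj => handleCount_of_two_le 1 k hj) ⟨oM⟩ b
  obtain ⟨z₀⟩ : Nonempty b.carrier := inferInstance
  set z : V := b.incl z₀ with hz
  have hzb : z ∈ (𝓡∂ 4).boundary V := b.range_incl ▸ mem_range_self z₀
  set ζ : Path z x₀ := PathConnectedSpace.somePath z x₀ with hζ
  set T : FundamentalGroup V x₀ ≃* FundamentalGroup V z := BasePointTransfer.pathConj ζ with hT
  set ez : FundamentalGroup V z ≃* FreeGroup (Fin k) := T.symm.trans e with hez
  set Sz : Set (MulAut (FreeGroup (Fin k))) :=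
    {θ | ∃ (G : V ≃ₘ⟮𝓡∂ 4, 𝓡∂ 4⟯ V) (hGz : G z = z), ∀ c, FundamentalGroup.mapOfEq (⟨G, G.continuous⟩ : C(V, V)) hGz c = ez.symm (θ (ez c))}
    with hSz
  -- inner automorphisms are realised at `z`
  have hinner : ∀ w : FreeGroup (Fin k), MulAut.conj w ∈ Sz := fun w => by
    obtain ⟨G, hGz, hG⟩ := exists_diffeomorph_mapOfEq_eq_conj hkV b z₀ (ez.symm w)
    refine ⟨G, hGz, fun c => ?_⟩
    rw [hG c, MulAut.conj_apply, map_mul, map_mul, map_inv, MulEquiv.symm_apply_apply]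
  -- the Nielsen automorphisms are realised at `z` up to inner automorphisms
  have hniel : ∀ ν ∈ nielsenGenerators k, ∃ d : FreeGroup (Fin k), MulAut.conj d * ν ∈ Sz := by
    intro ν hν
    obtain ⟨φ, ⟨G, hG, hφ⟩, hν⟩ := REAL₀ ν hν
    obtain ⟨G', hG', X, hX⟩ := exists_diffeomorph_fix_boundaryPoint b z₀ ζ G hG
    refine ⟨(ez X)⁻¹, G', hG', fun c => ?_⟩
    obtain ⟨c, rfl⟩ : ∃ c₀, T c₀ = c := T.surjective c
    have h3 : ∀ y, ez.symm y = T (e.symm y) := fun y => rfl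
    have h4 : ez (T c) = e c := by show e (T.symm (T c)) = e c; rw [MulEquiv.symm_apply_apply]
    have h5 : T (e.symm (ez X)) = X := by rw [← h3, MulEquiv.symm_apply_apply]
    rw [hX c, ← hφ c, hν c, MulAut.mul_apply, MulAut.conj_apply, h4, inv_inv, h3, map_mul, map_mul, map_mul, map_mul,
      map_inv, map_inv, h5]
  refine ⟨z, hzb, ez, Sz, ?_, ?_⟩
  · exact closure_eq_top_of_conj_mul_nielsen_mem Sz (fun i => Subgroup.subset_closure (hinner _))
      fun ν hν => by obtain ⟨d, hd⟩ := hniel ν hν; exact ⟨d, Subgroup.subset_closure hd⟩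
  · rintro ν ⟨G, hGz, hG⟩
    exact ⟨G, hGz, hG⟩

/-- **Laudenbach–Poénaru's Lemma 2 (Bull. SMF 100 (1972), §2): the named fact
`laudenbachPoenaru_exists_diffeoExtends_mapOfEq_eq` holds.** [cite: LaudenbachPoenaruBSMF1972, §2, Lemma 2 and its proof (pp. 339–340)] -/
theorem laudenbachPoenaru_exists_diffeoExtends_mapOfEq_eq_holds : laudenbachPoenaru_exists_diffeoExtends_mapOfEq_eq.{u} :=
  laudenbachPoenaru_exists_diffeoExtends_mapOfEq_eq_of_forall_realise fun k V _ _ _ _ _ _ _ hk ho => hk.exists_realise_autGenerators k V ho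

end Literature.Topology.FourManifolds
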